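import Literature.Computability.AlgebraicComplexity.RectangularExponentCertReduction
import Literature.Computability.AlgebraicComplexity.MonomialRestrictionProducts
import Literature.Barriers.MatrixMultiplication.UniversalMethodBarrierProducts
import Literature.Barriers.MatrixMultiplication.UniversalMethodBarrierDegenerationPow
import HarnessLib

/-!
# Calculus of `CW_5` degeneration certificates: amplification, extra powers of `CW_5`, and the
transfer of a certificate to a larger exponent `κ` (the `μ` row of the certified 2024 table) — proved

Topic `Literature/Computability/AlgebraicComplexity`; companion of
`RectangularExponentLaserCertificate.lean` (`CW5DegenerationCertificate`) and
`RectangularExponentCertReduction.lean`, whose module docstring argues in prose that a degeneration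
certificate for the `μ` row `(0.527661, 2.055322)` of `vxxz2024TableCertified` follows from one at the
published parameter file's own `(κ', ω') = (0.52766066425…, 2.05532132850…)`, `κ' < κ`, "by tensoring
with `CW_5^{⊗N₂} ≥ ⟨1, 5^{N₂}, 1⟩ at exponent cost `(κ−κ')·log₅ 7`".  This file PROVES that argument
in general:

* `bigCwTensor_restrictsTo_one_mid_one` — `CW_q ≥ ⟨1⟩ ⊗ ⟨1, q, 1⟩` (the zero-out
  `Σ_{i=1}^q x_0 y_i z_i`, VXXZ 2024 §3.6), hence `CW_q^{⊗N} ≥ ⟨1⟩ ⊗ ⟨1, q^N, 1⟩`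
  (`bigCwTensor_kroneckerPow_restrictsTo_one_mid_one`);
* `polyDegeneratesTo_cw_amplify` — **amplification and tensoring**: if
  `⟨t⟩ ⊗ CW_q^{⊗N} ⊵ ⟨V⟩ ⊗ ⟨A, B, C⟩` then for all `L, N₂`,
  `⟨t^L⟩ ⊗ CW_q^{⊗(L N + N₂)} ⊵ ⟨V^L⟩ ⊗ ⟨A^L, B^L q^{N₂}, C^L⟩` (Kronecker powers of a degeneration,
  `(⟨F⟩ ⊗ ⟨A,B,C⟩)^{⊗L} ≥ ⟨F^L⟩ ⊗ ⟨A^L,B^L,C^L⟩`, and the extra factor `CW_q^{⊗N₂} ≥ ⟨1⟩ ⊗ ⟨1,q^{N₂},1⟩`);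
* `CW5DegenerationCertificate.mono_kappa` — a certificate certifies every table whose rows `(κ, b)`
  are dominated by certified rows `(κ', b')` with `κ ≤ κ'`, `b' ≤ b` (e.g. the `α` row: the file is at
  `κ' = 0.321334051847 ≥ 0.321334`);
* `CW5DegenerationCertificate.transfer` — **transfer to a LARGER exponent**: rows `(κ, b)` dominated by
  certified rows `(κ', b')` with `0 ≤ κ' ≤ κ` and `b' + (κ − κ')·(log 7 / log 5) < b` are certified
  (amplify until `a^{Δ/2} ≥ 7`, `Δ` the slack of that inequality, then tensor with `CW_5^{⊗N₂}`,
  `N₂ = ⌈(κ−κ') log a^L / log 5⌉`);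
* `cw5Certificate_mu_row` — in particular a certificate at `(0.52766066425, 2.05532132851)` (rounded
  inside what the `mu` parameter file supports) gives one at the tabulated `μ` row
  `(0.527661, 2.055322)`, since `log 7 / log 5 < 5/4` (`7⁴ = 2401 < 3125 = 5⁵`) and
  `2.05532132851 + 0.00000033575 · 5/4 < 2.055322`; `cw5Certificate_mu_row'` — the same from
  `(0.52766066425, 2.0553214)`, the point at which the `mu` file was re-certified exactly by the
  harness (ledger item `wi-04482`, evidence of 2026-08-15).

Everything is proved; no definitions, no named facts.

## References

* V. Vassilevska Williams, Y. Xu, Z. Xu, R. Zhou, *New bounds for matrix multiplication: from alpha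
  to omega*, SODA 2024, arXiv:2307.07970, §3.3 (degenerations and Kronecker products), §3.4
  (`⟨a,b,c⟩ ⊗ ⟨d,e,f⟩ ≡ ⟨ad,be,cf⟩`), §3.6 (`CW_q` and its six blocks), §8 (parameters at osf.io/7wgh2,
  file `mu_0.52766067.mat`). [VassilevskaWilliamsXuXuZhou2024]
* M. Bläser, *Fast Matrix Multiplication*, ToC Graduate Surveys 5 (2013), §5.2. [Blaser2013]
-/

noncomputable section

open scoped BigOperators

namespace Literature.Computability.AlgebraicComplexity

open Literature.Barriers.MatrixMultiplication

universe u

/-! ## `CW_q ≥ ⟨1⟩ ⊗ ⟨1, q, 1⟩` and its powers -/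

section Blocks

variable (K : Type u) [CommSemiring K]

/-- Associativity of the Kronecker product as a restriction: `s ⊗ (x ⊗ y) ≥ (s ⊗ x) ⊗ y`
(relabelling along `Equiv.prodAssoc`). [folklore] -/
theorem tensorRestrictsTo_kronecker_assoc {ι κ μ ι₁ κ₁ μ₁ ι₂ κ₂ μ₂ : Type*} [Fintype ι] [Fintype κ]
    [Fintype μ] [Fintype ι₁] [Fintype κ₁] [Fintype μ₁] [Fintype ι₂] [Fintype κ₂] [Fintype μ₂]
    [DecidableEq ι] [DecidableEq κ] [DecidableEq μ] [DecidableEq ι₁] [DecidableEq κ₁]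
    [DecidableEq μ₁] [DecidableEq ι₂] [DecidableEq κ₂] [DecidableEq μ₂]
    (s : ι → κ → μ → K) (x : ι₁ → κ₁ → μ₁ → K) (y : ι₂ → κ₂ → μ₂ → K) :
    TensorRestrictsTo (kroneckerTensor s (kroneckerTensor x y))
      (kroneckerTensor (kroneckerTensor s x) y) := by
  have key : kroneckerTensor (kroneckerTensor s x) y = fun a b c =>
      kroneckerTensor s (kroneckerTensor x y) (Equiv.prodAssoc _ _ _ a) (Equiv.prodAssoc _ _ _ b)
        (Equiv.prodAssoc _ _ _ c) := by
    funext a b c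
    simp only [kroneckerTensor_apply, Equiv.prodAssoc_apply]
    ring
  rw [key]
  exact tensorRestrictsTo_precomp _ _ _ _

/-- **`CW_q ≥ ⟨1⟩ ⊗ ⟨1, q, 1⟩`**: the zero-out of `CW_q` to the block `Σ_{i=1}^q x_0 y_i z_i` is a
matrix multiplication tensor of format `(1, q, 1)` (VXXZ 2024, §3.6: the six blocks of `CW_q` are
`⟨1,1,q⟩, ⟨q,1,1⟩, ⟨1,q,1⟩` and three `⟨1,1,1⟩`), written as the multiple `⟨1⟩ ⊗ ⟨1, q, 1⟩`.
[cite: VassilevskaWilliamsXuXuZhou2024, §3.6] -/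
theorem bigCwTensor_restrictsTo_one_mid_one (q : ℕ) :
    TensorRestrictsTo (bigCwTensor K q) (kroneckerTensor (unitTensor K 1) (matMulTensor K 1 q 1)) := by
  have key : kroneckerTensor (unitTensor K 1) (matMulTensor K 1 q 1) =
      fun (a : Fin 1 × (Fin 1 × Fin 1)) (b : Fin 1 × (Fin 1 × Fin q)) (c : Fin 1 × (Fin q × Fin 1)) =>
        bigCwTensor K q ((fun _ => (0 : Fin (q + 2))) a) ((fun b => cwMid b.2.2) b)
          ((fun c => cwMid c.2.1) c) := by
    funext a b c
    obtain ⟨a₁, a₂, a₃⟩ := a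
    obtain ⟨b₁, b₂, b₃⟩ := b
    obtain ⟨c₁, c₂, c₃⟩ := c
    have ha₁ := Fin.fin_one_eq_zero a₁
    have hb₁ := Fin.fin_one_eq_zero b₁
    have hc₁ := Fin.fin_one_eq_zero c₁
    have ha₂ := Fin.fin_one_eq_zero a₂
    have ha₃ := Fin.fin_one_eq_zero a₃
    have hb₂ := Fin.fin_one_eq_zero b₂
    have hc₃ := Fin.fin_one_eq_zero c₃
    subst ha₁ hb₁ hc₁ ha₂ ha₃ hb₂ hc₃
    simp [kroneckerTensor_apply, matMulTensor, bigCwTensor_zero_mid_mid]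
  rw [key]
  exact tensorRestrictsTo_precomp _ _ _ _

/-- **`CW_q^{⊗N} ≥ ⟨1⟩ ⊗ ⟨1, q^N, 1⟩`** (powers of the previous zero-out,
`⟨1,q,1⟩^{⊗N} ≅ ⟨1, q^N, 1⟩`). [cite: VassilevskaWilliamsXuXuZhou2024, §3.4 and §3.6] -/
theorem bigCwTensor_kroneckerPow_restrictsTo_one_mid_one (q N : ℕ) :
    TensorRestrictsTo (kroneckerPow (bigCwTensor K q) N)
      (kroneckerTensor (unitTensor K 1) (matMulTensor K 1 (q ^ N) 1)) :=
  ((bigCwTensor_restrictsTo_one_mid_one K q).kroneckerPow N).trans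
    ((tensorRestrictsTo_kroneckerPow_multiple_matMulTensor K 1 1 q 1 N).trans
      (tensorRestrictsTo_multiple_matMulTensor_of_eq K (one_pow N) (one_pow N) rfl (one_pow N)))

/-! ## Amplification of a degeneration of `⟨t⟩ ⊗ CW_q^{⊗N}` and tensoring with `CW_q^{⊗N₂}` -/

/-- **Amplification.**  If `⟨t⟩ ⊗ CW_q^{⊗N} ⊵ ⟨V⟩ ⊗ ⟨A, B, C⟩` then for every `L`,
`⟨t^L⟩ ⊗ CW_q^{⊗(L N)} ⊵ ⟨V^L⟩ ⊗ ⟨A^L, B^L, C^L⟩` (`⟨t^L⟩ ≥ ⟨t⟩^{⊗L}`, `T^{⊗LN} ≥ (T^{⊗N})^{⊗L}`,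
`s^{⊗L} ⊗ u^{⊗L} ≥ (s ⊗ u)^{⊗L}`, the `L`-th Kronecker power of the degeneration, and
`(⟨V⟩ ⊗ ⟨A,B,C⟩)^{⊗L} ≥ ⟨V^L⟩ ⊗ ⟨A^L,B^L,C^L⟩`). [cite: VassilevskaWilliamsXuXuZhou2024, §3.3–§3.4] -/
theorem polyDegeneratesTo_cw_pow {q N t V A B C : ℕ}
    (h : PolyDegeneratesTo (kroneckerTensor (unitTensor K t) (kroneckerPow (bigCwTensor K q) N))
      (kroneckerTensor (unitTensor K V) (matMulTensor K A B C))) (L : ℕ) :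
    PolyDegeneratesTo (kroneckerTensor (unitTensor K (t ^ L)) (kroneckerPow (bigCwTensor K q) (L * N)))
      (kroneckerTensor (unitTensor K (V ^ L)) (matMulTensor K (A ^ L) (B ^ L) (C ^ L))) := by
  classical
  have h1 : TensorRestrictsTo
      (kroneckerTensor (unitTensor K (t ^ L)) (kroneckerPow (bigCwTensor K q) (L * N)))
      (kroneckerTensor (kroneckerPow (unitTensor K t) L)
        (kroneckerPow (kroneckerPow (bigCwTensor K q) N) L)) :=
    (tensorMonRestrictsTo_unitTensor_kroneckerPow_unitTensor (K := K) le_rfl).tensorRestrictsTo.kronecker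
      (tensorRestrictsTo_kroneckerPow_mul _ L N)
  have h2 : TensorRestrictsTo
      (kroneckerTensor (kroneckerPow (unitTensor K t) L)
        (kroneckerPow (kroneckerPow (bigCwTensor K q) N) L))
      (kroneckerPow (kroneckerTensor (unitTensor K t) (kroneckerPow (bigCwTensor K q) N)) L) :=
    (tensorMonRestrictsTo_kroneckerPow_kronecker' _ _ L).tensorRestrictsTo
  have h3 := h.kroneckerPow L
  have h4 := tensorRestrictsTo_kroneckerPow_multiple_matMulTensor K V A B C L
  exact ((h1.trans h2).trans_polyDegeneratesTo h3).trans_restrictsTo h4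

/-- **Amplification and tensoring with extra powers of `CW_q`.**  If
`⟨t⟩ ⊗ CW_q^{⊗N} ⊵ ⟨V⟩ ⊗ ⟨A, B, C⟩` then for all `L, N₂`,
`⟨t^L⟩ ⊗ CW_q^{⊗(L N + N₂)} ⊵ ⟨V^L⟩ ⊗ ⟨A^L, B^L · q^{N₂}, C^L⟩`: split off `CW_q^{⊗N₂}`
(`T^{⊗(m+n)} ≥ T^{⊗m} ⊗ T^{⊗n}`, associativity), tensor the amplified degeneration with
`CW_q^{⊗N₂} ≥ ⟨1⟩ ⊗ ⟨1, q^{N₂}, 1⟩`, and multiply the formats (`⟨a,b,c⟩ ⊗ ⟨d,e,f⟩ ≡ ⟨ad,be,cf⟩`).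
[cite: VassilevskaWilliamsXuXuZhou2024, §3.3–§3.6] -/
theorem polyDegeneratesTo_cw_amplify {q N t V A B C : ℕ}
    (h : PolyDegeneratesTo (kroneckerTensor (unitTensor K t) (kroneckerPow (bigCwTensor K q) N))
      (kroneckerTensor (unitTensor K V) (matMulTensor K A B C))) (L N₂ : ℕ) :
    PolyDegeneratesTo
      (kroneckerTensor (unitTensor K (t ^ L)) (kroneckerPow (bigCwTensor K q) (L * N + N₂)))
      (kroneckerTensor (unitTensor K (V ^ L)) (matMulTensor K (A ^ L) (B ^ L * q ^ N₂) (C ^ L))) := by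
  classical
  have s1 : TensorRestrictsTo
      (kroneckerTensor (unitTensor K (t ^ L)) (kroneckerPow (bigCwTensor K q) (L * N + N₂)))
      (kroneckerTensor (unitTensor K (t ^ L))
        (kroneckerTensor (kroneckerPow (bigCwTensor K q) (L * N)) (kroneckerPow (bigCwTensor K q) N₂))) :=
    (TensorRestrictsTo.refl _).kronecker (tensorRestrictsTo_kroneckerPow_add _ (L * N) N₂)
  have s2 := tensorRestrictsTo_kronecker_assoc K (unitTensor K (t ^ L))
    (kroneckerPow (bigCwTensor K q) (L * N)) (kroneckerPow (bigCwTensor K q) N₂)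
  have s3 := (polyDegeneratesTo_cw_pow K h L).kronecker
    (bigCwTensor_kroneckerPow_restrictsTo_one_mid_one K q N₂).polyDegeneratesTo
  have s4 := tensorRestrictsTo_kronecker_multiple_matMulTensor K (V ^ L) (A ^ L) (B ^ L) (C ^ L)
    1 1 (q ^ N₂) 1
  have s5 := tensorRestrictsTo_multiple_matMulTensor_of_eq K (mul_one (V ^ L)) (mul_one (A ^ L))
    (rfl : B ^ L * q ^ N₂ = B ^ L * q ^ N₂) (mul_one (C ^ L))
  exact (((s1.trans s2).trans_polyDegeneratesTo s3).trans_restrictsTo s4).trans_restrictsTo s5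

end Blocks

/-! ## Monotonicity and transfer of `CW_5` degeneration certificates in `κ` -/

section Transfer

/-- **Monotonicity in `κ` and `b`**: a `CW_5` degeneration certificate for `T` certifies every
table `T'` whose rows `(κ, b)` are dominated by rows `(κ', b')` of `T` with `κ ≤ κ'` and `b' ≤ b`
(the same degeneration: `B ≥ a^{κ'} ≥ a^κ` and `a^{b'+δ} ≤ a^{b+δ}` as `a ≥ 2`).  Example: the `α`
row of `vxxz2024TableCertified` at `κ = 0.321334` from the `alpha` parameter file at
`κ' = 0.321334051847`. [folklore] -/
theorem CW5DegenerationCertificate.mono_kappa {T T' : List (ℝ × ℝ)} (h : CW5DegenerationCertificate T)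
    (hTT' : ∀ k b : ℝ, (k, b) ∈ T' → ∃ k' b' : ℝ, (k', b') ∈ T ∧ k ≤ k' ∧ b' ≤ b) :
    CW5DegenerationCertificate T' := by
  intro k b hkb δ hδ
  obtain ⟨k', b', hkb', hkk', hbb'⟩ := hTT' k b hkb
  obtain ⟨N, t, V, a, B, hN, ht, hV, ha, haB, hdeg, hnum⟩ := h k' b' hkb' δ hδ
  have ha1 : (1 : ℝ) ≤ a := by exact_mod_cast (by omega : 1 ≤ a)
  refine ⟨N, t, V, a, B, hN, ht, hV, ha, (Real.rpow_le_rpow_of_exponent_le ha1 hkk').trans haB,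
    hdeg, hnum.trans ?_⟩
  exact mul_le_mul_of_nonneg_left (Real.rpow_le_rpow_of_exponent_le ha1 (by linarith))
    (Nat.cast_nonneg _)

/-- `log 7 / log 5 < 5/4`, i.e. `7⁴ = 2401 < 3125 = 5⁵`. [folklore] -/
theorem log_seven_div_log_five_lt : Real.log 7 / Real.log 5 < 5 / 4 := by
  have h5 : 0 < Real.log 5 := Real.log_pos (by norm_num)
  rw [div_lt_iff₀ h5]
  have h : Real.log ((7 : ℝ) ^ 4) < Real.log ((5 : ℝ) ^ 5) :=
    Real.log_lt_log (by norm_num) (by norm_num)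
  rw [Real.log_pow, Real.log_pow] at h
  push_cast at h
  linarith

/-- **Transfer of a certificate to a larger exponent `κ`** (the argument for the `μ` row of the
certified table, `RectangularExponentCertReduction.lean`, made a theorem): if every row `(κ, b)` of
`T'` is dominated by a certified row `(κ', b')` of `T` with `0 ≤ κ' ≤ κ` and
`b' + (κ − κ') · (log 7 / log 5) < b`, then `T'` is certified.  Proof: with `Δ > 0` the slack of the
last inequality, take the certified degeneration at `(κ', b')` for `δ' = Δ/2`, amplify it to the
`L`-th power with `(a^L)^{Δ/2} ≥ 7`, and tensor with `CW_5^{⊗N₂}`, `N₂ = ⌈(κ−κ') log a^L / log 5⌉`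
(`polyDegeneratesTo_cw_amplify`): the middle dimension becomes `B^L 5^{N₂} ≥ (a^L)^κ`, at the cost of
the factor `7^{N₂} ≤ 7 · (a^L)^{(κ−κ') log 7/log 5} ≤ (a^L)^{Δ/2 + (κ−κ') log 7 / log 5}`.
[cite: VassilevskaWilliamsXuXuZhou2024, §3.3–§3.6 (degenerations, Kronecker products, blocks of CW_q)] -/
theorem CW5DegenerationCertificate.transfer {T T' : List (ℝ × ℝ)} (h : CW5DegenerationCertificate T)
    (hTT' : ∀ k b : ℝ, (k, b) ∈ T' → ∃ k' b' : ℝ, (k', b') ∈ T ∧ 0 ≤ k' ∧ k' ≤ k ∧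
      b' + (k - k') * (Real.log 7 / Real.log 5) < b) :
    CW5DegenerationCertificate T' := by
  intro k b hkb δ hδ
  obtain ⟨k', b', hkb', hk'0, hkk', hlt⟩ := hTT' k b hkb
  set c : ℝ := Real.log 7 / Real.log 5 with hc
  set Δ : ℝ := b - b' - (k - k') * c with hΔ
  have hΔ0 : 0 < Δ := by rw [hΔ]; linarith
  obtain ⟨N, t, V, a, B, hN, ht, hV, ha, haB, hdeg, hnum⟩ := h k' b' hkb' (Δ / 2) (half_pos hΔ0)
  -- positivity facts
  have ha2 : (2 : ℝ) ≤ a := by exact_mod_cast ha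
  have ha0 : (0 : ℝ) < a := by linarith
  have hlog2 : 0 < Real.log 2 := Real.log_pos one_lt_two
  have hlog5 : 0 < Real.log 5 := Real.log_pos (by norm_num)
  have hlog7 : 0 < Real.log 7 := Real.log_pos (by norm_num)
  have hc0 : 0 ≤ c := div_nonneg hlog7.le hlog5.le
  -- the amplification exponent `L`: `2^{L Δ/2} ≥ 7`
  obtain ⟨L, hL⟩ : ∃ L : ℕ, L = ⌈2 * Real.log 7 / (Δ * Real.log 2)⌉₊ + 1 := ⟨_, rfl⟩
  have hL1 : 1 ≤ L := by rw [hL]; exact Nat.le_add_left 1 _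
  have hLge : 2 * Real.log 7 / (Δ * Real.log 2) ≤ L := by
    rw [hL]
    push_cast
    linarith [Nat.le_ceil (2 * Real.log 7 / (Δ * Real.log 2))]
  obtain ⟨A, hA⟩ : ∃ A : ℕ, A = a ^ L := ⟨_, rfl⟩
  have hAa : a ≤ A := by rw [hA]; exact Nat.le_self_pow (by omega) a
  have hA2 : 2 ≤ A := ha.trans hAa
  have hA1 : (1 : ℝ) ≤ A := by exact_mod_cast (by omega : 1 ≤ A)
  have hA0 : (0 : ℝ) < A := by linarith
  have hAcast : (A : ℝ) = (a : ℝ) ^ (L : ℝ) := by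
    rw [hA, Nat.cast_pow, Real.rpow_natCast]
  -- `7 ≤ A^{Δ/2}`
  have h7A : (7 : ℝ) ≤ (A : ℝ) ^ (Δ / 2) := by
    have hAlog : Real.log 2 * L ≤ Real.log A := by
      rw [hAcast, Real.log_rpow ha0]
      have := Real.log_le_log (by norm_num) ha2
      nlinarith
    have hexp : Real.log 7 ≤ Δ / 2 * Real.log A := by
      have h1 : 2 * Real.log 7 ≤ L * (Δ * Real.log 2) := by
        rwa [div_le_iff₀ (by positivity)] at hLge
      nlinarith
    calc (7 : ℝ) = Real.exp (Real.log 7) := (Real.exp_log (by norm_num)).symm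
      _ ≤ Real.exp (Δ / 2 * Real.log A) := Real.exp_le_exp.2 hexp
      _ = (A : ℝ) ^ (Δ / 2) := by rw [Real.rpow_def_of_pos hA0, mul_comm]
  -- the extra power `N₂` of `CW_5`: `A^{k-k'} ≤ 5^{N₂}` and `7^{N₂} ≤ 7 A^{(k-k') c}`
  obtain ⟨N₂, hN₂⟩ : ∃ N₂ : ℕ, N₂ = ⌈(k - k') * Real.log A / Real.log 5⌉₊ := ⟨_, rfl⟩
  have hkk0 : 0 ≤ (k - k') * Real.log A := mul_nonneg (by linarith) (Real.log_nonneg hA1)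
  have hN₂ge : (k - k') * Real.log A / Real.log 5 ≤ N₂ := by rw [hN₂]; exact Nat.le_ceil _
  have hN₂lt : (N₂ : ℝ) < (k - k') * Real.log A / Real.log 5 + 1 := by
    rw [hN₂]; exact Nat.ceil_lt_add_one (div_nonneg hkk0 hlog5.le)
  have h5N : (A : ℝ) ^ (k - k') ≤ (5 : ℝ) ^ N₂ := by
    rw [Real.rpow_def_of_pos hA0, ← Real.rpow_natCast (5 : ℝ) N₂,
      Real.rpow_def_of_pos (by norm_num : (0 : ℝ) < 5), Real.exp_le_exp]
    rw [div_le_iff₀ hlog5] at hN₂ge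
    linarith
  have h7N : (7 : ℝ) ^ N₂ ≤ 7 * (A : ℝ) ^ ((k - k') * c) := by
    have h1 : (N₂ : ℝ) * Real.log 7 ≤ ((k - k') * Real.log A / Real.log 5 + 1) * Real.log 7 :=
      mul_le_mul_of_nonneg_right hN₂lt.le hlog7.le
    calc (7 : ℝ) ^ N₂ = Real.exp (N₂ * Real.log 7) := by
          rw [← Real.rpow_natCast (7 : ℝ) N₂, Real.rpow_def_of_pos (by norm_num : (0 : ℝ) < 7),
            mul_comm]
      _ ≤ Real.exp (((k - k') * Real.log A / Real.log 5 + 1) * Real.log 7) := Real.exp_le_exp.2 h1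
      _ = 7 * (A : ℝ) ^ ((k - k') * c) := by
          rw [Real.rpow_def_of_pos hA0, add_mul, one_mul, Real.exp_add, Real.exp_log (by norm_num),
            mul_comm (Real.exp _) 7, hc]
          congr 2
          field_simp
  -- the witnesses
  refine ⟨L * N + N₂, t ^ L, V ^ L, A, B ^ L * 5 ^ N₂, ?_, Nat.one_le_pow _ _ ht,
    Nat.one_le_pow _ _ hV, hA2, ?_, ?_, ?_⟩
  · exact le_add_right (Nat.one_le_iff_ne_zero.2 (Nat.mul_ne_zero (by omega) (by omega)))
  · -- `A^k ≤ B^L 5^{N₂}`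
    have hAk' : (A : ℝ) ^ k' ≤ (B : ℝ) ^ L := by
      rw [hAcast, ← Real.rpow_mul ha0.le, mul_comm, Real.rpow_mul ha0.le, Real.rpow_natCast]
      exact pow_le_pow_left₀ (Real.rpow_nonneg ha0.le _) haB L
    calc (A : ℝ) ^ k = (A : ℝ) ^ k' * (A : ℝ) ^ (k - k') := by
          rw [← Real.rpow_add hA0]; ring_nf
      _ ≤ (B : ℝ) ^ L * (5 : ℝ) ^ N₂ :=
          mul_le_mul hAk' h5N (Real.rpow_nonneg hA0.le _) (pow_nonneg (Nat.cast_nonneg _) _)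
      _ = ((B ^ L * 5 ^ N₂ : ℕ) : ℝ) := by push_cast; ring
  · -- the degeneration
    have := polyDegeneratesTo_cw_amplify ℂ hdeg L N₂
    rwa [← hA] at this
  · -- the count: `t^L 7^{L N + N₂} ≤ V^L A^{b+δ}`
    have ht0 : (0 : ℝ) ≤ t := Nat.cast_nonneg _
    have hV0 : (0 : ℝ) ≤ V := Nat.cast_nonneg _
    have hpowL : ((t : ℝ) * 7 ^ N) ^ L ≤ ((V : ℝ) * (a : ℝ) ^ (b' + Δ / 2)) ^ L :=
      pow_le_pow_left₀ (by positivity) hnum L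
    have haL : ((a : ℝ) ^ (b' + Δ / 2)) ^ L = (A : ℝ) ^ (b' + Δ / 2) := by
      rw [hAcast, ← Real.rpow_natCast, ← Real.rpow_mul ha0.le, mul_comm, Real.rpow_mul ha0.le]
    have hexpb : b' + Δ / 2 + Δ / 2 + (k - k') * c = b := by rw [hΔ]; ring
    calc ((t ^ L : ℕ) : ℝ) * 7 ^ (L * N + N₂)
        = ((t : ℝ) * 7 ^ N) ^ L * 7 ^ N₂ := by push_cast; rw [pow_add, pow_mul']; ring
      _ ≤ ((V : ℝ) * (a : ℝ) ^ (b' + Δ / 2)) ^ L * (7 * (A : ℝ) ^ ((k - k') * c)) :=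
          mul_le_mul hpowL h7N (by positivity) (by positivity)
      _ = (V : ℝ) ^ L * ((A : ℝ) ^ (b' + Δ / 2) * 7 * (A : ℝ) ^ ((k - k') * c)) := by
          rw [mul_pow, haL]; ring
      _ ≤ (V : ℝ) ^ L * ((A : ℝ) ^ (b' + Δ / 2) * (A : ℝ) ^ (Δ / 2) * (A : ℝ) ^ ((k - k') * c)) := by
          gcongr
      _ = (V : ℝ) ^ L * (A : ℝ) ^ b := by
          rw [← Real.rpow_add hA0, ← Real.rpow_add hA0, hexpb]
      _ ≤ (V : ℝ) ^ L * (A : ℝ) ^ (b + δ) :=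
          mul_le_mul_of_nonneg_left (Real.rpow_le_rpow_of_exponent_le hA1 (by linarith))
            (by positivity)
      _ = ((V ^ L : ℕ) : ℝ) * (A : ℝ) ^ (b + δ) := by push_cast; ring

/-- **The `μ` row of the certified 2024 table from the published `mu` parameter file's own point.**
The file `mu_0.52766067.mat` is at `κ' = 0.527660664252783…` with stored objective
`ω' = 1 + 2κ' = 2.055321328505567…`; a certificate at the inner roundings
`(0.52766066425, 2.05532132851)` (implied by one at `(κ', ω')`, `mono_kappa`) transfers to the
tabulated `μ` row `(0.527661, 2.055322)`: `log 7 / log 5 < 5/4` and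
`2.05532132851 + (0.527661 − 0.52766066425) · 5/4 = 2.0553217481975 < 2.055322`.
[cite: VassilevskaWilliamsXuXuZhou2024, §8 (parameters at osf.io/7wgh2) and §1.1 Table 1 (μ row)] -/
theorem cw5Certificate_mu_row
    (h : CW5DegenerationCertificate [((0.52766066425 : ℝ), (2.05532132851 : ℝ))]) :
    CW5DegenerationCertificate [((0.527661 : ℝ), (2.055322 : ℝ))] := by
  refine h.transfer fun k b hkb => ?_
  simp only [List.mem_singleton, Prod.mk.injEq] at hkb
  obtain ⟨rfl, rfl⟩ := hkb
  refine ⟨0.52766066425, 2.05532132851, List.mem_singleton.2 rfl, by norm_num, by norm_num, ?_⟩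
  have hc := log_seven_div_log_five_lt
  have hc0 : 0 ≤ Real.log 7 / Real.log 5 :=
    div_nonneg (Real.log_nonneg (by norm_num)) (Real.log_nonneg (by norm_num))
  nlinarith

/-- **The `μ` row from the point at which the `mu` file was re-certified EXACTLY.**  The harness
re-certification of the published parameter files (ledger item `wi-04482`, evidence
`20260815T0443*-REPORT.md` / `report_all.json`, row `mu7`) verifies the authors' constraint program at
the `mu` file's own `κ' = 0.52766066425278…` with the bound `2.0553214` (the 7-decimal round-up of its
stored `ω' = 2.0553213285…`; exact final slack `1.75·10⁻⁷`).  A degeneration certificate at that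
point — hence, by `mono_kappa`, at the inner point `(0.52766066425, 2.0553214)` — transfers to the
tabulated `μ` row `(0.527661, 2.055322)`: `log 7 / log 5 < 5/4` and
`2.0553214 + (0.527661 − 0.52766066425) · 5/4 = 2.0553218196875 < 2.055322`.
[cite: VassilevskaWilliamsXuXuZhou2024, §8 (parameters at osf.io/7wgh2) and §1.1 Table 1 (μ row)] -/
theorem cw5Certificate_mu_row'
    (h : CW5DegenerationCertificate [((0.52766066425 : ℝ), (2.0553214 : ℝ))]) :
    CW5DegenerationCertificate [((0.527661 : ℝ), (2.055322 : ℝ))] := by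
  refine h.transfer fun k b hkb => ?_
  simp only [List.mem_singleton, Prod.mk.injEq] at hkb
  obtain ⟨rfl, rfl⟩ := hkb
  refine ⟨0.52766066425, 2.0553214, List.mem_singleton.2 rfl, by norm_num, by norm_num, ?_⟩
  have hc := log_seven_div_log_five_lt
  have hc0 : 0 ≤ Real.log 7 / Real.log 5 :=
    div_nonneg (Real.log_nonneg (by norm_num)) (Real.log_nonneg (by norm_num))
  nlinarith

end Transfer

end Literature.Computability.AlgebraicComplexity

end
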